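import Summits.Ventures.YMGap.RobustBall.RobustSlabConsistency
import Summits.Ventures.YMGap.RobustBall.RobustSlabHypotheses
import Summits.Ventures.YMGap.RobustBall.Defs
import HarnessLib

/-!
# Robust ball (Y2), area-law side, part 4 — `AreaLawOnBall` from the robust slab door (assembly against rb-theory's `Defs`)

HONEST FRAMING: venture file of the cell `pub-ymgap` (QuantumFields programme), track ROBUST-BALL.  ASSEMBLY (DESIGN §8 S3,
`AreaLawFromSlabCovarianceTarget`): if the robust SLAB DOOR delivers rest-uniform clustering `(C₁, C₂)` of the perturbed slab laws
`slabLawW v t (β/N) W.total r` for every member `W` of the tier-1 ball `ClusterDomainFR ε₀ ε₁ r` that is slab-local with vertical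
diameter `mv` (`IsSlabLocal mv W`), uniformly in `(L, W, v, t, r)`, then `AreaLawOnBall N (n+1) β ε₀ ε₁ r mv` holds with the explicit
constants of `robust_slab_criterion` (`C = max(max(N, e^{(C₂/2mv)M₀²}), 1)`, `c = C₂/(2mv)`).  The two structural hypotheses of the
criterion are DERIVED here from rb-theory's `IsSlabLocal`: (HLoc) from `vert_range` via `hasVerticalRange_finset_sum`, (HCentre) from
`center_inv` at the central element `e^{2πi/N}·I` (`slabRotate_eq_centerSlabRotate`, `centre_mem_center`).  The door itself (hypothesis
`hdoor`) is rb-p1's S2 and is NOT proved here.  Strong-coupling finite-lattice statement; nothing about the continuum, a mass gap, or Clay.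
-/

noncomputable section

open MeasureTheory
open Literature.MathematicalPhysics.QuantumLattice (fundamentalRep continuous_fundamentalRep fundamentalRep_apply)
open Literature.MathematicalPhysics.QuantumFieldTheory
open Literature.MathematicalPhysics.QuantumFieldTheory.DurhuusFrohlich

namespace Summit.Ventures.YMGap.RobustBall

open ProbabilityTheory

variable {n L N : ℕ}

section Bridge

variable [NeZero L]

omit [NeZero L] in
/-- My slab rotation is rb-theory's `centerSlabRotate` (same links, argument order swapped). [folklore] -/
theorem slabRotate_eq_centerSlabRotate (z : SU N) (v : Fin (n + 1)) (t : ZMod L) (U : GaugeConfig (n + 1) L (SU N)) :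
    slabRotate z v t U = centerSlabRotate v t z U := by
  funext e
  simp only [slabRotate, centerSlabRotate, IsSlab]
  split_ifs <;> rfl

/-- **(HLoc) for members of the area-law sub-ball**: `IsSlabLocal mv W` gives vertical range `mv` of `W.total` seen by every slab.
[folklore] -/
theorem hasVerticalRange_total_of_isSlabLocal {mv : ℕ} {W : Perturbation (n + 1) L N} (hW : IsSlabLocal mv W)
    (v : Fin (n + 1)) : HasVerticalRange W.total v mv := by
  have h := hasVerticalRange_finset_sum (N := N) (polymers (d := n + 1) (L := L) 1) (fun X U => W.act X U) v mv
    (fun X _ => hW.vert_range X v)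
  exact h

/-- **(HCentre) for members of the area-law sub-ball**: `IsSlabLocal mv W` gives invariance of `W.total` under the centre rotation
`e^{2πi/N}·I` of the vertical links of every slab. [folklore] -/
theorem total_slabRotate_centre_of_isSlabLocal (hN : N ≠ 0) {mv : ℕ} {W : Perturbation (n + 1) L N} (hW : IsSlabLocal mv W)
    (v : Fin (n + 1)) (t : ZMod L) (U : GaugeConfig (n + 1) L (SU N)) :
    W.total (slabRotate (centre N hN) v t U) = W.total U := by
  rw [slabRotate_eq_centerSlabRotate]
  exact hW.center_inv v t (centre N hN) (centre_mem_center hN) U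


omit [NeZero L] in
/-- A `v`-link at height `s` lies in the slab window `slabWindow v t₀ m` iff `s = t₀ + k` for some `k < m`. [folklore] -/
theorem not_isSlab_of_mem_slabWindow {v : Fin (n + 1)} {t₀ s : ZMod L} {m : ℕ} (hs : ¬ ∃ k : ℕ, k < m ∧ s = t₀ + k)
    {e : Edge (n + 1) L} (he : e ∈ slabWindow v t₀ m) : ¬ IsSlab v s e := by
  rintro ⟨hv, hh⟩
  rcases he with hne | ⟨k, hk, hke⟩
  · exact hne hv
  · exact hs ⟨k, hk, by rw [← hh, hke]⟩

/-- **Centre-slab invariance is DERIVED** (rb-theory's `IsSlabLocalOfVertRangeTarget`, torus dimension `n + 1`): vertical dependence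
diameter `m < L` plus the carrier's per-activity gauge invariance give `IsSlabLocal m W` — each activity is invariant under the centre
rotation of any slab by `apply_slabRotate_eq_of_isGaugeInvariant` (a height outside the activity's window exists since `m < L`; if the
rotated slab itself is outside the window there is nothing to prove). [folklore] -/
theorem isSlabLocal_of_hasVertRange {m : ℕ} (hmL : m < L) {W : Perturbation (n + 1) L N} (hW : HasVertRange m W) :
    IsSlabLocal m W := by
  classical
  refine ⟨fun v t z hz U => ?_, hW⟩
  rw [← slabRotate_eq_centerSlabRotate]
  simp only [QuasiLocalGaugePerturbation.total]
  refine Finset.sum_congr rfl fun X _ => ?_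
  obtain ⟨t₀, hdep⟩ := hW X v
  by_cases ht : ∃ k : ℕ, k < m ∧ t = t₀ + k
  · -- the slab `t` is inside the window: rotate instead a slab at a height `s` outside the window (exists as `m < L`)
    have hex : ∃ s : ZMod L, ¬ ∃ k : ℕ, k < m ∧ s = t₀ + k := by
      by_contra hall
      push Not at hall
      -- every height is `t₀ + k`, `k < m`: then the `L` heights `t₀ + j`, `j < L`, inject into `m < L` values
      have hsurj : ∀ j : ℕ, j < L → ∃ k : ℕ, k < m ∧ (t₀ + (j : ZMod L) : ZMod L) = t₀ + k := fun j _ => hall _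
      have hinj : Function.Injective fun j : Fin L => (⟨Classical.choose (hsurj j j.2),
          (Classical.choose_spec (hsurj j j.2)).1⟩ : Fin m) := by
        intro j j' hjj'
        have h1 := (Classical.choose_spec (hsurj j j.2)).2
        have h2 := (Classical.choose_spec (hsurj j' j'.2)).2
        simp only [Fin.mk.injEq] at hjj'
        rw [hjj'] at h1
        have h12 : (t₀ + (j : ℕ) : ZMod L) = t₀ + (j' : ℕ) := h1.trans h2.symm
        have := Literature.MathematicalPhysics.QuantumLattice.nat_eq_of_zmod_cast_eq j.2 j'.2 (add_left_cancel h12)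
        exact Fin.ext this
      have := Fintype.card_le_of_injective _ hinj
      simp only [Fintype.card_fin] at this
      omega
    obtain ⟨s, hs⟩ := hex
    have hst : s ≠ t := fun h => hs (h ▸ ht)
    exact apply_slabRotate_eq_of_isGaugeInvariant (W.isGaugeInvariant_act X) hdep v t
      ⟨s, hst, fun e he => not_isSlab_of_mem_slabWindow hs he⟩ hz U
  · -- the slab `t` is outside the window: the activity does not see it
    refine hdep fun e he => ?_
    have hns : ¬ IsSlab v t e := not_isSlab_of_mem_slabWindow ht he
    simp only [slabRotate, if_neg hns]

end Bridge

section Assembly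

/-- **AREA LAW ON THE BALL FROM THE ROBUST SLAB DOOR** (DESIGN §8 S3 / `AreaLawFromSlabCovarianceTarget`).  Let `N ≥ 2`, `β` the TREE
coupling (plaquette weight `e^{-β(N - Re tr U_p)}`, 't Hooft `β/N`), `mv ≥ 1`.  If for every torus `L`, every `W ∈ ClusterDomainFR ε₀ ε₁ r`
with `IsSlabLocal mv W`, every direction `v`, height `t` and off-slab configuration, the perturbed slab law clusters with constants
`(C₁, C₂)`, `C₂ > 0` — the output of the robust slab door — then `AreaLawOnBall N (n+1) β ε₀ ε₁ r mv`: Wilson's area law for the loop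
expectation under EVERY member's measure, constants `max(max(N, e^{(C₂/2mv)M₀²}),1)^{2(R+T)} e^{-(C₂/2mv)RT}` uniform on the ball.
[cite: CaoNissimSheffield2025dynamical, Theorem 2.3] -/
theorem areaLawOnBall_of_slabCovariance (hN : 2 ≤ N) (β ε₀ ε₁ : ℝ) (r : ℕ) {mv : ℕ} (hmv : 1 ≤ mv) {C₁ C₂ : ℝ}
    (hC₂ : 0 < C₂)
    (hdoor : ∀ (L : ℕ) [NeZero L] (W : Perturbation (n + 1) L N), W ∈ ClusterDomainFR ε₀ ε₁ r → IsSlabLocal mv W →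
      ∀ (v : Fin (n + 1)) (t : ZMod L) (rest : {e : Edge (n + 1) L // ¬ IsSlab v t e} → SU N) (x y : Site n L)
        (i j k l : Fin N) (φ ψ : ℂ → ℝ), (φ = Complex.re ∨ φ = Complex.im) → (ψ = Complex.re ∨ ψ = Complex.im) →
          |cov[fun Q => φ ((Q x : Matrix (Fin N) (Fin N) ℂ) i j),
              fun Q => ψ ((((Q y)⁻¹ : Matrix.specialUnitaryGroup (Fin N) ℂ) : Matrix (Fin N) (Fin N) ℂ) k l);
              slabLawW v t (β / N) W.total rest]| ≤ C₁ * Real.exp (-C₂ * torusGraphDist x y)) :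
    AreaLawOnBall N (n + 1) β ε₀ ε₁ r mv := by
  set A₀ : ℝ := max (N : ℝ) (Real.exp (C₂ / (2 * mv) *
    (2 * Real.log (max (((N : ℝ) ^ 2) ^ mv * (4 * C₁)) 1) / C₂) ^ 2)) with hA₀
  refine ⟨max A₀ 1, C₂ / (2 * mv), div_pos hC₂ (by positivity), ?_⟩
  intro L _ W hWball hWloc x i j R T hij hR hT hRL hTL
  have hNr : (N : ℝ) ≠ 0 := by exact_mod_cast (show N ≠ 0 by omega)
  have hβ : (N : ℝ) * (β / N) = β := by field_simp
  have h := robust_slab_criterion_quasiLocal (n := n) (L := L) hN (β / N) W hmv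
    (fun v => hasVerticalRange_total_of_isSlabLocal hWloc v)
    (fun v t U => total_slabRotate_centre_of_isSlabLocal (by omega) hWloc v t U) hC₂
    (fun v t rest x' y' i' j' k' l' φ ψ hφ hψ => hdoor L W hWball hWloc v t rest x' y' i' j' k' l' φ ψ hφ hψ) x hij hRL hTL
  rw [hβ] at h
  exact areaLaw_shape_of_le (by omega) h

/-- **Consistency of the ball area law with the tree's `HasAreaLaw`** (rb-theory's `AreaLawOnBallConsistency`, rb-ref T1.3): the zero
perturbation is a member of every tier-1 ball with `0 ≤ ε₀, ε₁` and is slab-local, and its expectation is the Wilson expectation, so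
`AreaLawOnBall N d β ε₀ ε₁ r mv → HasAreaLaw d (fundamentalRep (Fin N)) β`. [folklore] -/
theorem areaLawOnBallConsistency_of_nonneg {d : ℕ} (β : ℝ) {ε₀ ε₁ : ℝ} (h₀ : 0 ≤ ε₀) (h₁ : 0 ≤ ε₁) (r mv : ℕ) :
    AreaLawOnBallConsistency N d β ε₀ ε₁ r mv := by
  intro hAL
  obtain ⟨C, c, hc, hW⟩ := hAL
  refine ⟨C, c, hc, fun L _ x i j R T hij hR hT hRL hTL => ?_⟩
  have hz : IsSlabLocal mv (0 : Perturbation d L N) :=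
    { center_inv := fun v t z _ U => by simp
      vert_range := fun X v => ⟨0, fun _ _ _ => rfl⟩ }
  have h := hW L 0 (zero_mem_clusterDomainFR h₀ h₁ r) hz x i j R T hij hR hT hRL hTL
  rwa [QuasiLocalGaugePerturbation.expectation_zero] at h

end Assembly

end Summit.Ventures.YMGap.RobustBall
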